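import Mathlib.FieldTheory.IsAlgClosed.AlgebraicClosure
import Mathlib.FieldTheory.Minpoly.IsIntegrallyClosed
import Mathlib.Data.ZMod.Basic
import Literature.NumberTheory.EllipticCurves.IsogenyFormulaCert
import HarnessLib

/-!
# Isogeny certificates checked by Kronecker substitution, and a coprimality certificate

Trunk T-ELLARITH; topic `NumberTheory/EllipticCurves`, notion `cm_endomorphisms_isogeny` (explicit
isogenies). The tree's `Literature.NumberTheory.EllipticCurves.IsogenyFormulaCert` decides whether
integer data `(W₁, W₂, U, h, S, T)` form an isogeny formula
`(x, y) ↦ (U(x)/h(x)², (S(x)y + T(x))/h(x)³)` (Silverman, *AEC*, Thm. III.4.8) by computing the two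
defining polynomial identities coefficientwise with list arithmetic in the kernel
(`IsogenyCert.check`). For the CM isogenies of degree `43, 67, 163` this is too slow (the identity
has degree `3ℓ` and coefficients of several hundred digits; schoolbook list products cost minutes
to hours of kernel time). This file provides an equivalent check that the kernel closes in
seconds, and a certificate format for the coprimality of `U` and `h` (needed to read the degree
of the isogeny off the formula, `IsogenyFormulaDegree`):

* **Kronecker substitution.** An integer polynomial `P` with `2‖P‖₁ < B` vanishes as soon as
  `P(B) = 0` (`isZeroL_of_evalL_eq_zero`: the constant term is divisible by `B` and smaller than
  `B/2`, hence `0`; induct). The `1`-norm of the two identity polynomials `id₁L c`, `id₀L c` is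
  bounded *a priori* by the same expression in the `1`-norms of `U, h, S, T`
  (`‖p q‖₁ ≤ ‖p‖₁ ‖q‖₁`, `‖p + q‖₁ ≤ ‖p‖₁ + ‖q‖₁`; `norm1L_id₁L_le`, `norm1L_id₀L_le`), and their
  value at `B` is the same expression in the *integers* `U(B), h(B), S(B), T(B)`
  (`evalL_id₁L`, `evalL_id₀L`). So `IsogenyCert.checkFast c k` evaluates the four input lists at
  `B = 2ᵏ` by Horner's rule and tests two integer identities and two inequalities — a handful of
  GMP operations for the kernel — and `IsogenyCert.check_of_checkFast` recovers the tree's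
  `c.check = true`, whence `IsogenyCert.toFormula` applies unchanged.
* **Coprimality.** `CoprimeCert` = a prime `ℓ` and lists `a, b, q` with
  `a·Ū + b·h̄ = 1 + ℓ q` in `ℤ[X]`, where `Ū, h̄` are `U, h` reduced entrywise mod `ℓ` (so all
  entries are small); checked again by Kronecker substitution (`IsogenyCert.checkCoprime`). If
  moreover `h` is monic then `U` and `h` are coprime over every field of characteristic `0`
  (`IsogenyCert.isCoprime_of_checkCoprime`): a common root `α` in an algebraic closure would be
  an algebraic integer whose minimal polynomial over `ℤ` divides `U` and `h`
  (`minpoly.isIntegrallyClosed_dvd`), hence divides `1` in `(ℤ/ℓ)[X]` while remaining monic of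
  positive degree.

## References

* [SilvermanAEC2009] J. H. Silverman, *The Arithmetic of Elliptic Curves*, 2nd ed., GTM 106
  (2009), Thm. III.4.8 and Remark III.4.13.3.
* Kronecker substitution and the modular test for coprimality are textbook computer algebra
  (J. von zur Gathen, J. Gerhard, *Modern Computer Algebra*, 3rd ed., CUP 2013, §8.4 and §6.7);
  no result of that book is used, only the idea. [folklore]

## Design

Everything computable lives on `List ℤ` (constant term first) next to the tree's `addL`, `mulL`,
…; correctness is transported through the tree's interpretation `ofList : List ℤ → R[X]` and its
lemmas, so no polynomial identity is re-proved. `force` makes the kernel evaluate the four Horner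
values once (call-by-need is not guaranteed by the kernel's call-by-name reduction). No
`native_decide`: the checks are meant for `decide +kernel`.
-/

namespace Literature.NumberTheory.EllipticCurves.PolyCert

/-! ### Horner evaluation, `1`-norm, entrywise reduction -/

/-- Horner evaluation of a coefficient list at an integer: `evalL β [c₀, c₁, …] = c₀ + β (c₁ + β (…))`.
[folklore] -/
def evalL (β : ℤ) : List ℤ → ℤ
  | [] => 0
  | a :: p => a + β * evalL β p

/-- The `1`-norm `Σ |cᵢ|` of a coefficient list. [folklore] -/
def norm1L : List ℤ → ℕ
  | [] => 0
  | a :: p => a.natAbs + norm1L p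

/-- Entrywise reduction of a coefficient list modulo `ℓ` (representatives in `[0, ℓ)`). [folklore] -/
def modL (ℓ : ℕ) (p : List ℤ) : List ℤ :=
  p.map fun a => a % (ℓ : ℤ)

/-- Continuation-passing evaluation of an integer to weak head normal form before use: `force z k`
reduces to `k z` only after `z` has been computed, so that `k` may use its argument several times
without recomputation by the kernel. [folklore] -/
def force {α : Sort*} (z : ℤ) (k : ℤ → α) : α :=
  match z with
  | Int.ofNat n => k (Int.ofNat n)
  | Int.negSucc n => k (Int.negSucc n)

/-- `force z k = k z`. [folklore] -/
theorem force_eq {α : Sort*} (z : ℤ) (k : ℤ → α) : force z k = k z := by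
  cases z <;> rfl

/-- `evalL` on `nil`. [folklore] -/
@[simp] theorem evalL_nil (β : ℤ) : evalL β [] = 0 := rfl

/-- `evalL` on `cons`. [folklore] -/
@[simp] theorem evalL_cons (β a : ℤ) (p : List ℤ) : evalL β (a :: p) = a + β * evalL β p := rfl

/-- `norm1L` on `nil`. [folklore] -/
@[simp] theorem norm1L_nil : norm1L [] = 0 := rfl

/-- `norm1L` on `cons`. [folklore] -/
@[simp] theorem norm1L_cons (a : ℤ) (p : List ℤ) : norm1L (a :: p) = a.natAbs + norm1L p := rfl

end Literature.NumberTheory.EllipticCurves.PolyCert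

noncomputable section

open Polynomial

namespace Literature.NumberTheory.EllipticCurves.PolyCert

/-! ### `evalL` is evaluation of the interpretation -/

/-- **Horner evaluation is polynomial evaluation**: `evalL β p = (ofList p)(β)` in `ℤ`. [folklore] -/
theorem evalL_eq_eval_ofList (β : ℤ) : ∀ p : List ℤ, evalL β p = (ofList p : ℤ[X]).eval β
  | [] => by simp
  | a :: p => by
      rw [evalL_cons, ofList_cons, eval_add, eval_C, eval_mul, eval_X, evalL_eq_eval_ofList β p,
        Int.cast_id]

/-- `evalL` is additive w.r.t. `addL`. [folklore] -/
theorem evalL_addL (β : ℤ) (p q : List ℤ) : evalL β (addL p q) = evalL β p + evalL β q := by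
  simp only [evalL_eq_eval_ofList, ofList_addL, eval_add]

/-- `evalL` turns `negL` into negation. [folklore] -/
theorem evalL_negL (β : ℤ) (p : List ℤ) : evalL β (negL p) = -evalL β p := by
  simp only [evalL_eq_eval_ofList, ofList_negL, eval_neg]

/-- `evalL` turns `subL` into subtraction. [folklore] -/
theorem evalL_subL (β : ℤ) (p q : List ℤ) : evalL β (subL p q) = evalL β p - evalL β q := by
  simp only [evalL_eq_eval_ofList, ofList_subL, eval_sub]

/-- `evalL` turns `smulL a` into multiplication by `a`. [folklore] -/
theorem evalL_smulL (β a : ℤ) (p : List ℤ) : evalL β (smulL a p) = a * evalL β p := by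
  simp only [evalL_eq_eval_ofList, ofList_smulL, eval_mul, eval_C, Int.cast_id]

/-- `evalL` is multiplicative w.r.t. `mulL`. [folklore] -/
theorem evalL_mulL (β : ℤ) (p q : List ℤ) : evalL β (mulL p q) = evalL β p * evalL β q := by
  simp only [evalL_eq_eval_ofList, ofList_mulL, eval_mul]

/-! ### `1`-norm estimates -/

/-- Every entry is bounded by the `1`-norm. [folklore] -/
theorem natAbs_le_norm1L {a : ℤ} : ∀ {p : List ℤ}, a ∈ p → a.natAbs ≤ norm1L p
  | [], h => absurd h (by simp)
  | b :: p, h => by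
      rw [norm1L_cons]
      rcases List.mem_cons.mp h with rfl | h
      · exact Nat.le_add_right _ _
      · exact le_add_left (natAbs_le_norm1L h)

/-- `‖p + q‖₁ ≤ ‖p‖₁ + ‖q‖₁`. [folklore] -/
theorem norm1L_addL_le : ∀ p q : List ℤ, norm1L (addL p q) ≤ norm1L p + norm1L q
  | [], q => by simp [addL]
  | a :: p, [] => by simp [addL]
  | a :: p, b :: q => by
      rw [addL, norm1L_cons, norm1L_cons, norm1L_cons]
      have := norm1L_addL_le p q
      have hab := Int.natAbs_add_le a b
      omega

/-- `‖-p‖₁ = ‖p‖₁`. [folklore] -/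
theorem norm1L_negL (p : List ℤ) : norm1L (negL p) = norm1L p := by
  induction p with
  | nil => rfl
  | cons a p ih =>
      simp only [negL, List.map_cons, norm1L_cons, Int.natAbs_neg] at ih ⊢
      rw [ih]

/-- `‖p - q‖₁ ≤ ‖p‖₁ + ‖q‖₁`. [folklore] -/
theorem norm1L_subL_le (p q : List ℤ) : norm1L (subL p q) ≤ norm1L p + norm1L q := by
  rw [subL]
  exact (norm1L_addL_le p (negL q)).trans (by rw [norm1L_negL])

/-- `‖map (a * ·) p‖₁ = |a| ‖p‖₁`. [folklore] -/
theorem norm1L_map_mul (a : ℤ) : ∀ p : List ℤ, norm1L (p.map fun b => a * b) = a.natAbs * norm1L p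
  | [] => by simp
  | b :: p => by
      rw [List.map_cons, norm1L_cons, norm1L_cons, norm1L_map_mul a p, Int.natAbs_mul, mul_add]

/-- `‖a p‖₁ ≤ |a| ‖p‖₁`. [folklore] -/
theorem norm1L_smulL_le (a : ℤ) (p : List ℤ) : norm1L (smulL a p) ≤ a.natAbs * norm1L p := by
  unfold smulL
  split_ifs with ha
  · simp
  · exact (norm1L_map_mul a p).le

/-- `‖p q‖₁ ≤ ‖p‖₁ ‖q‖₁`. [folklore] -/
theorem norm1L_mulL_le : ∀ p q : List ℤ, norm1L (mulL p q) ≤ norm1L p * norm1L q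
  | [], q => by simp [mulL]
  | a :: p, q => by
      rw [mulL, norm1L_cons, add_mul]
      refine (norm1L_addL_le _ _).trans (Nat.add_le_add (norm1L_smulL_le a q) ?_)
      rw [norm1L_cons, Int.natAbs_zero, zero_add]
      exact norm1L_mulL_le p q

/-- Transitive form of `norm1L_addL_le`. [folklore] -/
theorem norm1L_addL_le_of {p q : List ℤ} {x y : ℕ} (hp : norm1L p ≤ x) (hq : norm1L q ≤ y) :
    norm1L (addL p q) ≤ x + y :=
  (norm1L_addL_le p q).trans (Nat.add_le_add hp hq)

/-- Transitive form of `norm1L_subL_le`. [folklore] -/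
theorem norm1L_subL_le_of {p q : List ℤ} {x y : ℕ} (hp : norm1L p ≤ x) (hq : norm1L q ≤ y) :
    norm1L (subL p q) ≤ x + y :=
  (norm1L_subL_le p q).trans (Nat.add_le_add hp hq)

/-- Transitive form of `norm1L_mulL_le`. [folklore] -/
theorem norm1L_mulL_le_of {p q : List ℤ} {x y : ℕ} (hp : norm1L p ≤ x) (hq : norm1L q ≤ y) :
    norm1L (mulL p q) ≤ x * y :=
  (norm1L_mulL_le p q).trans (Nat.mul_le_mul hp hq)

/-- Transitive form of `norm1L_smulL_le`. [folklore] -/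
theorem norm1L_smulL_le_of (a : ℤ) {q : List ℤ} {y : ℕ} (hq : norm1L q ≤ y) :
    norm1L (smulL a q) ≤ a.natAbs * y :=
  (norm1L_smulL_le a q).trans (Nat.mul_le_mul_left _ hq)

/-! ### Kronecker substitution -/

/-- **Kronecker substitution.** An integer coefficient list of `1`-norm `< B/2` whose Horner value
at `B` vanishes is a list of zeros: the constant term `a` satisfies `B ∣ a` and `2|a| < B`, so
`a = 0`, and one inducts on the tail. [folklore] -/
theorem isZeroL_of_evalL_eq_zero {B : ℕ} (hB : 0 < B) :
    ∀ p : List ℤ, 2 * norm1L p < B → evalL B p = 0 → isZeroL p = true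
  | [], _, _ => rfl
  | a :: p, hn, he => by
      rw [norm1L_cons] at hn
      rw [evalL_cons] at he
      have ha : a = 0 := by
        by_contra ha
        have hdvd : (B : ℤ) ∣ a := ⟨-evalL B p, by linear_combination he⟩
        have hle : B ≤ a.natAbs :=
          Nat.le_of_dvd (Int.natAbs_pos.mpr ha) (by simpa using Int.natAbs_dvd_natAbs.mpr hdvd)
        omega
      subst ha
      have hB0 : (B : ℤ) ≠ 0 := by exact_mod_cast hB.ne'
      have he' : evalL B p = 0 := by
        rw [zero_add] at he
        rcases mul_eq_zero.mp he with h | h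
        · exact absurd h hB0
        · exact h
      rw [isZeroL_cons, isZeroL_of_evalL_eq_zero hB p (by omega) he']
      rfl

/-! ### The fast check of an isogeny certificate -/

namespace IsogenyCert

variable (c : IsogenyCert)

/-- The integer `id₁(B)`, as a function of `B` and of the values `U(B), h(B), S(B), T(B)`; it
mirrors `id₁L`. [folklore] -/
def evalId₁ (β U h S T : ℤ) : ℤ :=
  2 * (S * T) + (c.a₁' * (U * h) + c.a₃' * (h * (h * h))) * S - S * S * (c.a₃ + β * (c.a₁ + β * 0))

/-- The integer `id₀(B)`, as a function of `B` and of `U(B), h(B), S(B), T(B)`; it mirrors `id₀L`.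
[folklore] -/
def evalId₀ (β U h S T : ℤ) : ℤ :=
  let h2 := h * h
  let h3 := h2 * h
  let h4 := h2 * h2
  let h6 := h4 * h2
  let U2 := U * U
  T * T + (c.a₁' * (U * h) + c.a₃' * h3) * T -
      (U2 * U + c.a₂' * (U2 * h2) + (c.a₄' * (U * h4) + c.a₆' * h6)) +
    S * S * (c.a₆ + β * (c.a₄ + β * (c.a₂ + β * (1 + β * 0))))

/-- A priori bound for `‖id₁L c‖₁` in terms of the `1`-norms of `U, h, S, T`. [folklore] -/
def bound₁ : ℕ :=
  let nU := norm1L c.U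
  let nh := norm1L c.h
  let nS := norm1L c.S
  let nT := norm1L c.T
  (2 : ℤ).natAbs * (nS * nT) +
      (c.a₁'.natAbs * (nU * nh) + c.a₃'.natAbs * (nh * (nh * nh))) * nS +
    nS * nS * (c.a₃.natAbs + (c.a₁.natAbs + 0))

/-- A priori bound for `‖id₀L c‖₁` in terms of the `1`-norms of `U, h, S, T`. [folklore] -/
def bound₀ : ℕ :=
  let nU := norm1L c.U
  let nh := norm1L c.h
  let nS := norm1L c.S
  let nT := norm1L c.T
  let n2 := nh * nh
  let n3 := n2 * nh
  let n4 := n2 * n2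
  let n6 := n4 * n2
  let m2 := nU * nU
  nT * nT + (c.a₁'.natAbs * (nU * nh) + c.a₃'.natAbs * n3) * nT +
      (m2 * nU + c.a₂'.natAbs * (m2 * n2) + (c.a₄'.natAbs * (nU * n4) + c.a₆'.natAbs * n6)) +
    nS * nS * (c.a₆.natAbs + (c.a₄.natAbs + (c.a₂.natAbs + ((1 : ℤ).natAbs + 0))))

/-- **The fast certificate check** (a closed `Bool` for `decide +kernel`): with `B = 2ᵏ`, the two
identities evaluated at `B` vanish, `2 · bound < B` for both a priori bounds, and the degree /
leading-coefficient conditions of `IsogenyCert.check` hold. [folklore] -/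
def checkFast (k : ℕ) : Bool :=
  let B : ℤ := ((2 ^ k : ℕ) : ℤ)
  force (evalL B c.U) fun U => force (evalL B c.h) fun h =>
    force (evalL B c.S) fun S => force (evalL B c.T) fun T =>
      (c.evalId₁ B U h S T == 0) && (c.evalId₀ B U h S T == 0) &&
        decide (2 * c.bound₁ < 2 ^ k) && decide (2 * c.bound₀ < 2 ^ k) &&
        decide (2 * (c.h.length - 1) < c.U.length - 1) &&
        !(coeffL c.U (c.U.length - 1) == 0) && !(coeffL c.h (c.h.length - 1) == 0)

variable {c}

/-- `id₁L` evaluated at `β` is `evalId₁`. [folklore] -/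
theorem evalL_id₁L (β : ℤ) :
    evalL β c.id₁L = c.evalId₁ β (evalL β c.U) (evalL β c.h) (evalL β c.S) (evalL β c.T) := by
  simp only [id₁L, evalId₁, evalL_subL, evalL_addL, evalL_mulL, evalL_smulL, evalL_cons, evalL_nil]

/-- `id₀L` evaluated at `β` is `evalId₀`. [folklore] -/
theorem evalL_id₀L (β : ℤ) :
    evalL β c.id₀L = c.evalId₀ β (evalL β c.U) (evalL β c.h) (evalL β c.S) (evalL β c.T) := by
  simp only [id₀L, evalId₀, evalL_subL, evalL_addL, evalL_mulL, evalL_smulL, evalL_cons, evalL_nil]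

/-- `‖id₁L c‖₁ ≤ bound₁ c`. [folklore] -/
theorem norm1L_id₁L_le : norm1L c.id₁L ≤ c.bound₁ :=
  norm1L_subL_le_of
    (norm1L_addL_le_of (norm1L_smulL_le_of 2 (norm1L_mulL_le_of le_rfl le_rfl))
      (norm1L_mulL_le_of
        (norm1L_addL_le_of (norm1L_smulL_le_of _ (norm1L_mulL_le_of le_rfl le_rfl))
          (norm1L_smulL_le_of _ (norm1L_mulL_le_of le_rfl (norm1L_mulL_le_of le_rfl le_rfl))))
        le_rfl))
    (norm1L_mulL_le_of (norm1L_mulL_le_of le_rfl le_rfl) le_rfl)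

/-- `‖id₀L c‖₁ ≤ bound₀ c`. [folklore] -/
theorem norm1L_id₀L_le : norm1L c.id₀L ≤ c.bound₀ := by
  have h2 : norm1L (mulL c.h c.h) ≤ norm1L c.h * norm1L c.h := norm1L_mulL_le_of le_rfl le_rfl
  have h3 : norm1L (mulL (mulL c.h c.h) c.h) ≤ norm1L c.h * norm1L c.h * norm1L c.h :=
    norm1L_mulL_le_of h2 le_rfl
  have h4 : norm1L (mulL (mulL c.h c.h) (mulL c.h c.h)) ≤
      norm1L c.h * norm1L c.h * (norm1L c.h * norm1L c.h) := norm1L_mulL_le_of h2 h2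
  have h6 : norm1L (mulL (mulL (mulL c.h c.h) (mulL c.h c.h)) (mulL c.h c.h)) ≤
      norm1L c.h * norm1L c.h * (norm1L c.h * norm1L c.h) * (norm1L c.h * norm1L c.h) :=
    norm1L_mulL_le_of h4 h2
  have hU2 : norm1L (mulL c.U c.U) ≤ norm1L c.U * norm1L c.U := norm1L_mulL_le_of le_rfl le_rfl
  exact norm1L_addL_le_of
    (norm1L_subL_le_of
      (norm1L_addL_le_of (norm1L_mulL_le_of le_rfl le_rfl)
        (norm1L_mulL_le_of
          (norm1L_addL_le_of (norm1L_smulL_le_of _ (norm1L_mulL_le_of le_rfl le_rfl))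
            (norm1L_smulL_le_of _ h3))
          le_rfl))
      (norm1L_addL_le_of
        (norm1L_addL_le_of (norm1L_mulL_le_of hU2 le_rfl)
          (norm1L_smulL_le_of _ (norm1L_mulL_le_of hU2 h2)))
        (norm1L_addL_le_of (norm1L_smulL_le_of _ (norm1L_mulL_le_of le_rfl h4))
          (norm1L_smulL_le_of _ h6))))
    (norm1L_mulL_le_of (norm1L_mulL_le_of le_rfl le_rfl) le_rfl)

/-- Unpacking a successful fast check. [folklore] -/
theorem checkFast_spec {k : ℕ} (hc : c.checkFast k = true) :
    c.evalId₁ ((2 ^ k : ℕ) : ℤ) (evalL ((2 ^ k : ℕ) : ℤ) c.U) (evalL ((2 ^ k : ℕ) : ℤ) c.h)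
        (evalL ((2 ^ k : ℕ) : ℤ) c.S) (evalL ((2 ^ k : ℕ) : ℤ) c.T) = 0 ∧
      c.evalId₀ ((2 ^ k : ℕ) : ℤ) (evalL ((2 ^ k : ℕ) : ℤ) c.U) (evalL ((2 ^ k : ℕ) : ℤ) c.h)
        (evalL ((2 ^ k : ℕ) : ℤ) c.S) (evalL ((2 ^ k : ℕ) : ℤ) c.T) = 0 ∧
      2 * c.bound₁ < 2 ^ k ∧ 2 * c.bound₀ < 2 ^ k ∧
      2 * (c.h.length - 1) < c.U.length - 1 ∧
      coeffL c.U (c.U.length - 1) ≠ 0 ∧ coeffL c.h (c.h.length - 1) ≠ 0 := by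
  simp only [checkFast, force_eq, Bool.and_eq_true, beq_iff_eq, decide_eq_true_eq,
    Bool.not_eq_true', beq_eq_false_iff_ne, ne_eq] at hc
  exact ⟨hc.1.1.1.1.1.1, hc.1.1.1.1.1.2, hc.1.1.1.1.2, hc.1.1.1.2, hc.1.1.2, hc.1.2, hc.2⟩

/-- A successful fast check gives `isZeroL (id₁L c)`. [folklore] -/
theorem isZeroL_id₁L_of_checkFast {k : ℕ} (hc : c.checkFast k = true) : isZeroL c.id₁L = true := by
  obtain ⟨h1, -, hb, -⟩ := checkFast_spec hc
  refine isZeroL_of_evalL_eq_zero (B := 2 ^ k) (pow_pos two_pos k) c.id₁L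
    (lt_of_le_of_lt (Nat.mul_le_mul_left 2 norm1L_id₁L_le) hb) ?_
  rw [evalL_id₁L]
  exact h1

/-- A successful fast check gives `isZeroL (id₀L c)`. [folklore] -/
theorem isZeroL_id₀L_of_checkFast {k : ℕ} (hc : c.checkFast k = true) : isZeroL c.id₀L = true := by
  obtain ⟨-, h0, -, hb, -⟩ := checkFast_spec hc
  refine isZeroL_of_evalL_eq_zero (B := 2 ^ k) (pow_pos two_pos k) c.id₀L
    (lt_of_le_of_lt (Nat.mul_le_mul_left 2 norm1L_id₀L_le) hb) ?_
  rw [evalL_id₀L]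
  exact h0

/-- **The fast check implies the tree's check**: `c.checkFast k = true → c.check = true`, so that
`IsogenyCert.toFormula` and `IsogenyCert.isIsogenous` apply to certificates closed by the fast
check. [cite: SilvermanAEC2009, Thm. III.4.8 and Remark III.4.13.3] -/
theorem check_of_checkFast {k : ℕ} (hc : c.checkFast k = true) : c.check = true := by
  obtain ⟨-, -, -, -, h3, h4, h5⟩ := checkFast_spec hc
  simp only [check, isZeroL_id₁L_of_checkFast hc, isZeroL_id₀L_of_checkFast hc, Bool.true_and,
    Bool.and_eq_true, decide_eq_true_eq, Bool.not_eq_true', beq_eq_false_iff_ne, ne_eq]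
  exact ⟨⟨h3, h4⟩, h5⟩

end IsogenyCert

/-! ### Coprimality certificates -/

/-- **A certificate of coprimality modulo a prime** for the lists `U, h` of an `IsogenyCert`:
a modulus `ℓ` and coefficient lists `a, b, q` with `a · Ū + b · h̄ = 1 + ℓ · q` in `ℤ[X]`, where
`Ū = modL ℓ U`, `h̄ = modL ℓ h` (so that `a U + b h ≡ 1 (mod ℓ)`). [folklore] -/
structure CoprimeCert where
  /-- The modulus (a prime). -/
  ℓ : ℕ
  /-- Bézout coefficient of `U` modulo `ℓ`. -/
  a : List ℤ
  /-- Bézout coefficient of `h` modulo `ℓ`. -/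
  b : List ℤ
  /-- The quotient `(a Ū + b h̄ - 1)/ℓ`. -/
  q : List ℤ

namespace IsogenyCert

variable (c : IsogenyCert) (d : CoprimeCert)

/-- The list `a Ū + b h̄ - 1 - ℓ q` whose vanishing the coprimality check certifies. [folklore] -/
def copL : List ℤ :=
  subL (subL (addL (mulL d.a (modL d.ℓ c.U)) (mulL d.b (modL d.ℓ c.h))) [1]) (smulL d.ℓ d.q)

/-- A priori bound for `‖copL c d‖₁`. [folklore] -/
def boundCop : ℕ :=
  norm1L d.a * norm1L (modL d.ℓ c.U) + norm1L d.b * norm1L (modL d.ℓ c.h) +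
      ((1 : ℤ).natAbs + 0) + (d.ℓ : ℤ).natAbs * norm1L d.q

/-- **The coprimality check** (a closed `Bool` for `decide +kernel`): with `B = 2ᵏ`,
`(a Ū + b h̄ - 1 - ℓ q)(B) = 0`, `2 · boundCop < B`, and the last listed coefficient of `h` is `1`
(`h` monic). [folklore] -/
def checkCoprime (k : ℕ) : Bool :=
  let B : ℤ := ((2 ^ k : ℕ) : ℤ)
  (evalL B (c.copL d) == 0) && decide (2 * c.boundCop d < 2 ^ k) &&
    (coeffL c.h (c.h.length - 1) == 1)

variable {c d}

/-- `‖copL c d‖₁ ≤ boundCop c d`. [folklore] -/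
theorem norm1L_copL_le : norm1L (c.copL d) ≤ c.boundCop d :=
  norm1L_subL_le_of
    (norm1L_subL_le_of
      (norm1L_addL_le_of (norm1L_mulL_le_of le_rfl le_rfl) (norm1L_mulL_le_of le_rfl le_rfl))
      le_rfl)
    (norm1L_smulL_le_of _ le_rfl)

/-- A successful coprimality check: the certified list vanishes and `h` has last coefficient `1`.
[folklore] -/
theorem checkCoprime_spec {k : ℕ} (hc : c.checkCoprime d k = true) :
    isZeroL (c.copL d) = true ∧ coeffL c.h (c.h.length - 1) = 1 := by
  simp only [checkCoprime, Bool.and_eq_true, beq_iff_eq, decide_eq_true_eq] at hc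
  obtain ⟨⟨he, hb⟩, hm⟩ := hc
  exact ⟨isZeroL_of_evalL_eq_zero (B := 2 ^ k) (pow_pos two_pos k) _
    (lt_of_le_of_lt (Nat.mul_le_mul_left 2 norm1L_copL_le) hb) he, hm⟩

/-- `ofList` commutes with ring maps. [folklore] -/
theorem map_ofList {R S : Type*} [CommRing R] [CommRing S] (f : R →+* S) :
    ∀ p : List ℤ, (ofList p : R[X]).map f = ofList p
  | [] => by simp
  | a :: p => by
      rw [ofList_cons, ofList_cons, Polynomial.map_add, Polynomial.map_mul, map_C, map_X,
        map_ofList f p, map_intCast]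

/-- Reducing the entries mod `ℓ` does not change the interpretation in `(ℤ/ℓ)[X]`. [folklore] -/
theorem ofList_modL (ℓ : ℕ) : ∀ p : List ℤ, (ofList (modL ℓ p) : (ZMod ℓ)[X]) = ofList p
  | [] => rfl
  | a :: p => by
      rw [modL, List.map_cons, ofList_cons, ofList_cons, ← modL, ofList_modL ℓ p, ZMod.intCast_mod]

/-- The last listed coefficient, when non-zero, sits in degree `natDegree`. [folklore] -/
theorem natDegree_ofList_eq {R : Type*} [CommRing R] [CharZero R] (p : List ℤ)
    (h : coeffL p (p.length - 1) ≠ 0) : (ofList p : R[X]).natDegree = p.length - 1 :=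
  le_antisymm (natDegree_ofList_le p) (le_natDegree_ofList p _ h)

/-- A list whose last listed coefficient is `1` interprets to a monic polynomial (characteristic
`0`). [folklore] -/
theorem monic_ofList {R : Type*} [CommRing R] [CharZero R] (p : List ℤ)
    (h : coeffL p (p.length - 1) = 1) : (ofList p : R[X]).Monic := by
  have h0 : coeffL p (p.length - 1) ≠ 0 := by rw [h]; exact one_ne_zero
  rw [Monic, leadingCoeff, natDegree_ofList_eq p h0, coeff_ofList, h, Int.cast_one]

/-- **Bézout modulo `ℓ`**: a successful coprimality check gives `ā U + b̄ h = 1` in `(ℤ/ℓ)[X]`.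
[folklore] -/
theorem bezout_zmod {k : ℕ} (hc : c.checkCoprime d k = true) :
    (ofList d.a : (ZMod d.ℓ)[X]) * ofList c.U + ofList d.b * ofList c.h = 1 := by
  have hZ : (ofList (c.copL d) : ℤ[X]) = 0 := ofList_eq_zero_of_isZeroL _ (checkCoprime_spec hc).1
  have := congrArg (Polynomial.map (Int.castRingHom (ZMod d.ℓ))) hZ
  rw [map_ofList, Polynomial.map_zero] at this
  simp only [copL, ofList_subL, ofList_addL, ofList_mulL, ofList_smulL, ofList_modL, ofList_cons,
    ofList_nil, Int.cast_one, map_one, mul_zero, add_zero, Int.cast_natCast, ZMod.natCast_self,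
    map_zero, zero_mul, sub_zero, sub_eq_zero] at this
  exact this

/-- **Coprimality from the certificate.** If `checkCoprime` succeeds with a prime modulus `ℓ`, then
`U` and `h` (read in any field `L` of characteristic `0`) are coprime: a common root `α` in an
algebraic closure of `L` is integral over `ℤ` (`h` is monic), its minimal polynomial `m ∈ ℤ[X]`
divides `U` and `h` (`minpoly.isIntegrallyClosed_dvd`), so `m̄ ∣ ā U + b̄ h = 1` in `(ℤ/ℓ)[X]`;
but `m̄` is monic of degree `deg m ≥ 1`. [folklore] -/
theorem isCoprime_of_checkCoprime {k : ℕ} (hc : c.checkCoprime d k = true) (hℓ : d.ℓ.Prime)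
    (L : Type*) [Field L] [CharZero L] :
    IsCoprime (ofList c.U : L[X]) (ofList c.h : L[X]) := by
  haveI : Fact d.ℓ.Prime := ⟨hℓ⟩
  refine (Polynomial.isCoprime_iff_aeval_ne_zero_of_isAlgClosed L (AlgebraicClosure L) _ _).mpr ?_
  intro α
  by_contra hα
  push Not at hα
  obtain ⟨hU, hh⟩ := hα
  -- read `U`, `h` over `ℤ`
  have hmon : (ofList c.h : ℤ[X]).Monic := monic_ofList _ (checkCoprime_spec hc).2
  have hhZ : aeval α (ofList c.h : ℤ[X]) = 0 := by
    rw [← hh, aeval_def, aeval_def, ← eval_map, ← eval_map, map_ofList, map_ofList]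
  have hUZ : aeval α (ofList c.U : ℤ[X]) = 0 := by
    rw [← hU, aeval_def, aeval_def, ← eval_map, ← eval_map, map_ofList, map_ofList]
  have hint : IsIntegral ℤ α := ⟨_, hmon, by rwa [aeval_def] at hhZ⟩
  have hdU : minpoly ℤ α ∣ (ofList c.U : ℤ[X]) := minpoly.isIntegrallyClosed_dvd hint hUZ
  have hdh : minpoly ℤ α ∣ (ofList c.h : ℤ[X]) := minpoly.isIntegrallyClosed_dvd hint hhZ
  -- reduce mod `ℓ`
  set m := (minpoly ℤ α).map (Int.castRingHom (ZMod d.ℓ)) with hm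
  have hmU : m ∣ (ofList c.U : (ZMod d.ℓ)[X]) := by
    rw [← map_ofList (Int.castRingHom (ZMod d.ℓ))]; exact Polynomial.map_dvd _ hdU
  have hmh : m ∣ (ofList c.h : (ZMod d.ℓ)[X]) := by
    rw [← map_ofList (Int.castRingHom (ZMod d.ℓ))]; exact Polynomial.map_dvd _ hdh
  have hm1 : m ∣ 1 := by
    rw [← bezout_zmod hc]
    exact dvd_add (dvd_mul_of_dvd_right hmU _) (dvd_mul_of_dvd_right hmh _)
  have hunit : IsUnit m := isUnit_of_dvd_one hm1
  have hdeg0 : m.natDegree = 0 := natDegree_eq_zero_of_isUnit hunit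
  have hdeg : m.natDegree = (minpoly ℤ α).natDegree := (minpoly.monic hint).natDegree_map _
  have hpos : 0 < (minpoly ℤ α).natDegree := minpoly.natDegree_pos hint
  omega

end IsogenyCert

end Literature.NumberTheory.EllipticCurves.PolyCert

end
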